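import Summits.SmoothPoincare4.SmoothPoincare4.Theorems.InformationMetricHadamardAhHadamardFillingFisherSphereGaussDefs
import Literature.Geometry.Lorentzian.TangentialConnection
import Literature.Geometry.Lorentzian.VolumeProofs

/-!
# Smooth families of functions on a compact manifold as `C(K, ℝ)`-valued smooth maps
(crux `InformationMetricHadamard.AhHadamardFilling`, item stmt-SmoothPoincare4-6014, line `fisher-sphere-gauss`,
stub K2 `stub_hellingerGaussEquation` — the Gauss equation of the Hellinger map). The stub's proof
(`…StubHellingerGaussEquation.lean`) is split by topic into three helper files and the stub file
(tree rule: Theorems files ≤ 400 lines):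
1. `…StubHellingerGaussEquationFamilies.lean` — a jointly smooth family `f : P → K → ℝ` over a
   compact manifold `K` as a `C^∞` map `P → C(K, ℝ)` (differentiation uniformly in `x ∈ K`);
2. `…StubHellingerGaussEquationImmersion.lean` — the Gauss equation of an isometric immersion of a
   manifold into a flat real inner product space, for any torsion-free compatible connection
   (from the tangential Gauss formula of `Literature/Geometry/Lorentzian/TangentialConnection.lean`);
3. `…StubHellingerGaussEquationLpFamily.lean` — the family as a `C^∞` map `W → L²(N, μ)` with
   differential `X ↦ [D1 θ w X]`;
4. `…StubHellingerGaussEquation.lean` — the registered stub.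
Authorship: stub-worker of the line lead prover-line-stmt-SmoothPoincare4-6014-c3-0 (wave 1).

References: J. M. Lee, *Introduction to Riemannian Manifolds* (2nd ed. 2018), Thm. 8.2, Prop. 8.1,
Thm. 8.5 (Gauss formula / equation); J. Dieudonné, *Foundations of Modern Analysis* (1960), (8.11.2);
S. Lang, *Real and Functional Analysis*, XIII §8; D. Groisser, M. K. Murray, dg-ga/9611008, §2.
-/

noncomputable section

-- the prescribed namespace `Summit.<P>.<Sub>.…` duplicates `SmoothPoincare4` (P = Sub)
set_option linter.dupNamespace false

open scoped Manifold ContDiff Topology ENNReal NNReal RealInnerProductSpace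
open Set Function MeasureTheory Topology Filter Bundle

namespace Summit.SmoothPoincare4.SmoothPoincare4.Cruxes.AhHadamardFilling.FisherSphereGauss

/-! ## Part A. Smooth families of functions on a compact space as `C(K, ℝ)`-valued smooth maps -/

section Family

variable {P : Type*} [NormedAddCommGroup P] [NormedSpace ℝ P] {K : Type*} [TopologicalSpace K]

/-- A continuous family `x ↦ D x` of linear forms on a finite-dimensional space `P`, indexed by a
topological space `K`, is a continuous linear map `P → C(K, ℝ)`, `X ↦ (x ↦ D x X)`. [folklore] -/
theorem exists_clm_curry [FiniteDimensional ℝ P] {D : K → P →L[ℝ] ℝ} (hD : Continuous D) :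
    ∃ L : P →L[ℝ] C(K, ℝ), ∀ X x, L X x = D x X := by
  let L₀ : P →ₗ[ℝ] C(K, ℝ) :=
    { toFun := fun X ↦ ⟨fun x ↦ D x X, (ContinuousLinearMap.apply ℝ ℝ X).continuous.comp hD⟩
      map_add' := fun X Y ↦ by ext x; simp
      map_smul' := fun c X ↦ by ext x; simp }
  exact ⟨LinearMap.toContinuousLinearMap L₀, fun X x ↦ rfl⟩

/-- **Differentiation of a family of functions, uniformly over a compact index space.** Let
`f : P → K → ℝ` be such that, for `p` near `p₀`, every `f · x` has derivative `f' p x` at `p`,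
with `(p, x) ↦ f' p x` jointly continuous at the points of `{p₀} × K`, `K` compact. Then the
curried map `F : P → C(K, ℝ)` (any map agreeing with `p ↦ f p` near `p₀`) has Fréchet derivative
`X ↦ (x ↦ f' p₀ x X)` at `p₀` for the sup norm: by the mean value inequality on a ball and
uniform continuity of `f'` on a tube around `{p₀} × K`. (Dieudonné, *Foundations of Modern
Analysis*, (8.11.2); Lang, *Real and Functional Analysis*, XIII §8.) [folklore] -/
theorem hasFDerivAt_curry [CompactSpace K] {f : P → K → ℝ} {f' : P → K → P →L[ℝ] ℝ}
    {F : P → C(K, ℝ)} {L : P →L[ℝ] C(K, ℝ)} {p₀ : P}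
    (hf : ∀ᶠ p in 𝓝 p₀, ∀ x, HasFDerivAt (fun q ↦ f q x) (f' p x) p)
    (hf' : ∀ x, ContinuousAt (fun q : P × K ↦ f' q.1 q.2) (p₀, x))
    (hF : ∀ᶠ p in 𝓝 p₀, ∀ x, F p x = f p x) (hL : ∀ X x, L X x = f' p₀ x X) :
    HasFDerivAt F L p₀ := by
  rw [hasFDerivAt_iff_isLittleO, Asymptotics.isLittleO_iff]
  intro c hc
  -- uniform continuity of `f'` on a tube around `{p₀} × K`
  have h1 : ∀ᶠ p in 𝓝 p₀, ∀ x ∈ (univ : Set K), ‖f' p x - f' p₀ x‖ < c := by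
    refine isCompact_univ.eventually_forall_of_forall_eventually fun x _ ↦ ?_
    have hA : ContinuousAt (fun q : P × K ↦ f' q.1 q.2) (p₀, x) := hf' x
    have hB : ContinuousAt (fun q : P × K ↦ f' p₀ q.2) (p₀, x) :=
      ContinuousAt.comp_of_eq (g := fun q : P × K ↦ f' q.1 q.2)
        (f := fun q : P × K ↦ ((p₀, q.2) : P × K)) (hf' x)
        (continuousAt_const.prodMk continuousAt_snd) rfl
    have ht : Tendsto (fun q : P × K ↦ ‖f' q.1 q.2 - f' p₀ q.2‖) (𝓝 (p₀, x)) (𝓝 0) := by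
      simpa using ((hA.sub hB).norm).tendsto
    exact ht.eventually_lt_const hc
  obtain ⟨δ, hδ, hball⟩ := Metric.eventually_nhds_iff_ball.1 (h1.and (hf.and hF))
  refine Metric.eventually_nhds_iff_ball.2 ⟨δ, hδ, fun p hp ↦ ?_⟩
  have hp₀ : p₀ ∈ Metric.ball p₀ δ := Metric.mem_ball_self hδ
  refine (ContinuousMap.norm_le _ (by positivity)).2 fun x ↦ ?_
  have e1 : (F p - F p₀ - L (p - p₀)) x = f p x - f p₀ x - f' p₀ x (p - p₀) := by
    simp only [ContinuousMap.sub_apply, (hball p hp).2.2 x, (hball p₀ hp₀).2.2 x, hL]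
  rw [e1]
  exact (convex_ball p₀ δ).norm_image_sub_le_of_norm_hasFDerivWithin_le'
    (f := fun q ↦ f q x) (f' := fun q ↦ f' q x)
    (fun q hq ↦ ((hball q hq).2.1 x).hasFDerivWithinAt)
    (fun q hq ↦ ((hball q hq).1 x (mem_univ x)).le) hp₀ hp

variable {EK : Type*} [NormedAddCommGroup EK] [NormedSpace ℝ EK] {HK : Type*}
  [TopologicalSpace HK] {IK : ModelWithCorners ℝ EK HK} [ChartedSpace HK K] [IsManifold IK ∞ K]

/-- For a jointly `C^∞` family `f : P → K → ℝ` (smooth on the product manifold `P × K` at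
`(p₀, x₀)`), the partial derivative in the parameter, `(p, x) ↦ ∂₁ f (p, x) ∈ P →L[ℝ] ℝ`, is
jointly `C^∞` at `(p₀, x₀)` (Mathlib's `ContMDiffAt.mfderiv`, read in the trivial tangent
coordinates of the vector spaces `P` and `ℝ`). [folklore] -/
theorem contMDiffAt_fderiv_family {f : P → K → ℝ} {p₀ : P} {x₀ : K}
    (hf : ContMDiffAt (𝓘(ℝ, P).prod IK) 𝓘(ℝ, ℝ) ∞ (uncurry f) (p₀, x₀)) :
    ContMDiffAt (𝓘(ℝ, P).prod IK) 𝓘(ℝ, P →L[ℝ] ℝ) ∞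
      (fun q : P × K ↦ fderiv ℝ (fun p ↦ f p q.2) q.1) (p₀, x₀) := by
  have h1 : ContMDiffAt ((𝓘(ℝ, P).prod IK).prod 𝓘(ℝ, P)) 𝓘(ℝ, ℝ) ∞
      (uncurry fun (q : P × K) (p : P) ↦ f p q.2) ((p₀, x₀), p₀) := by
    have e : (uncurry fun (q : P × K) (p : P) ↦ f p q.2) =
        uncurry f ∘ fun z : (P × K) × P ↦ (z.2, z.1.2) := rfl
    rw [e]
    exact ContMDiffAt.comp_of_eq hf (contMDiffAt_snd.prodMk contMDiffAt_fst.snd) rfl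
  have h2 := h1.mfderiv (fun (q : P × K) (p : P) ↦ f p q.2) Prod.fst contMDiffAt_fst
    (m := ∞) le_rfl
  rw [inTangentCoordinates_model_space] at h2
  simpa only [mfderiv_eq_fderiv] using h2

omit [IsManifold IK ∞ K] in
/-- Each member `f · x` of a jointly `C^∞` family is `C^∞` in the parameter. [folklore] -/
theorem contDiffAt_family_apply {f : P → K → ℝ} {p : P} {x : K}
    (hf : ContMDiffAt (𝓘(ℝ, P).prod IK) 𝓘(ℝ, ℝ) ∞ (uncurry f) (p, x)) :
    ContDiffAt ℝ ∞ (fun q ↦ f q x) p := by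
  have : ContMDiffAt 𝓘(ℝ, P) 𝓘(ℝ, ℝ) ∞ (uncurry f ∘ fun q : P ↦ (q, x)) p :=
    hf.comp p (contMDiffAt_id.prodMk contMDiffAt_const)
  exact contMDiffAt_iff_contDiffAt.1 this

variable [FiniteDimensional ℝ P] [CompactSpace K]

/-- **The curried map of a jointly smooth family is differentiable, with derivative the
pointwise parameter derivative.** If `f : P → K → ℝ` is jointly `C^∞` at every point of
`{p} × K` for `p` near `p₀` (`K` a compact manifold) and `F : P → C(K, ℝ)` agrees with `p ↦ f p`
near `p₀`, then `F` has a Fréchet derivative `L` at `p₀` with `(L X)(x) = ∂₁f(p₀, x) X`.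
[folklore] -/
theorem hasFDerivAt_curry_family {f : P → K → ℝ} {F : P → C(K, ℝ)} {p₀ : P}
    (hf : ∀ᶠ p in 𝓝 p₀, ∀ x, ContMDiffAt (𝓘(ℝ, P).prod IK) 𝓘(ℝ, ℝ) ∞ (uncurry f) (p, x))
    (hF : ∀ᶠ p in 𝓝 p₀, ∀ x, F p x = f p x) :
    ∃ L : P →L[ℝ] C(K, ℝ),
      (∀ X x, L X x = fderiv ℝ (fun p ↦ f p x) p₀ X) ∧ HasFDerivAt F L p₀ := by
  have hf₀ : ∀ x, ContMDiffAt (𝓘(ℝ, P).prod IK) 𝓘(ℝ, ℝ) ∞ (uncurry f) (p₀, x) :=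
    hf.self_of_nhds
  have hD : Continuous fun x ↦ fderiv ℝ (fun p ↦ f p x) p₀ := by
    rw [continuous_iff_continuousAt]
    intro x
    exact (contMDiffAt_fderiv_family (hf₀ x)).continuousAt.comp
      (f := fun y : K ↦ ((p₀, y) : P × K)) (continuousAt_const.prodMk continuousAt_id)
  obtain ⟨L, hL⟩ := exists_clm_curry hD
  refine ⟨L, hL, hasFDerivAt_curry (f' := fun p x ↦ fderiv ℝ (fun q ↦ f q x) p) ?_ ?_ hF hL⟩
  · filter_upwards [hf] with p hp x
    exact ((contDiffAt_family_apply (hp x)).differentiableAt (by simp)).hasFDerivAt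
  · intro x
    exact (contMDiffAt_fderiv_family (hf₀ x)).continuousAt

/-- **Smoothness of the curried map, finite order.** If `f : P → K → ℝ` is jointly `C^∞` at
every point of `S × K` (`S ⊆ P` open, `K` a compact manifold, `P` finite-dimensional) and
`F : P → C(K, ℝ)` agrees with `p ↦ f p` on `S`, then `F` is `C^n` on `S` for every `n : ℕ`:
induction on `n`, the derivative of `F` in a fixed direction being the curried map of the
corresponding partial derivative of `f` (Mathlib's `contDiffOn_succ_iff_fderiv_apply`).
[folklore] -/
theorem contDiffOn_curry_family_nat {S : Set P} (hS : IsOpen S) (n : ℕ) :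
    ∀ {f : P → K → ℝ} {F : P → C(K, ℝ)},
      (∀ p ∈ S, ∀ x, ContMDiffAt (𝓘(ℝ, P).prod IK) 𝓘(ℝ, ℝ) ∞ (uncurry f) (p, x)) →
      (∀ p ∈ S, ∀ x, F p x = f p x) → ContDiffOn ℝ n F S := by
  induction n with
  | zero =>
    intro f F hf hF
    rw [Nat.cast_zero, contDiffOn_zero]
    intro p hp
    have hev : (∀ᶠ q in 𝓝 p, ∀ x, ContMDiffAt (𝓘(ℝ, P).prod IK) 𝓘(ℝ, ℝ) ∞ (uncurry f) (q, x)) ∧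
        ∀ᶠ q in 𝓝 p, ∀ x, F q x = f q x :=
      ⟨eventually_of_mem (hS.mem_nhds hp) hf, eventually_of_mem (hS.mem_nhds hp) hF⟩
    obtain ⟨L, -, hFL⟩ := hasFDerivAt_curry_family hev.1 hev.2
    exact hFL.continuousAt.continuousWithinAt
  | succ n ih =>
    intro f F hf hF
    have hev : ∀ p ∈ S,
        (∀ᶠ q in 𝓝 p, ∀ x, ContMDiffAt (𝓘(ℝ, P).prod IK) 𝓘(ℝ, ℝ) ∞ (uncurry f) (q, x)) ∧
        ∀ᶠ q in 𝓝 p, ∀ x, F q x = f q x := fun p hp ↦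
      ⟨eventually_of_mem (hS.mem_nhds hp) hf, eventually_of_mem (hS.mem_nhds hp) hF⟩
    rw [Nat.cast_succ, contDiffOn_succ_iff_fderiv_apply hS.uniqueDiffOn]
    refine ⟨fun p hp ↦ ?_, fun h ↦ absurd h (by simp), fun Y ↦ ?_⟩
    · obtain ⟨L, -, hFL⟩ := hasFDerivAt_curry_family (hev p hp).1 (hev p hp).2
      exact hFL.differentiableAt.differentiableWithinAt
    · refine ih (f := fun p x ↦ fderiv ℝ (fun q ↦ f q x) p Y) (fun p hp x ↦ ?_) (fun p hp x ↦ ?_)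
      · exact (contMDiffAt_fderiv_family (hf p hp x)).clm_apply contMDiffAt_const
      · rw [fderivWithin_of_isOpen hS hp]
        obtain ⟨L, hL, hFL⟩ := hasFDerivAt_curry_family (hev p hp).1 (hev p hp).2
        rw [hFL.fderiv, hL]

/-- **Smoothness of the curried map.** Under the hypotheses of `contDiffOn_curry_family_nat`,
`F : P → C(K, ℝ)` is `C^∞` on `S`. [folklore] -/
theorem contDiffOn_curry_family {S : Set P} (hS : IsOpen S) {f : P → K → ℝ} {F : P → C(K, ℝ)}
    (hf : ∀ p ∈ S, ∀ x, ContMDiffAt (𝓘(ℝ, P).prod IK) 𝓘(ℝ, ℝ) ∞ (uncurry f) (p, x))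
    (hF : ∀ p ∈ S, ∀ x, F p x = f p x) : ContDiffOn ℝ ∞ F S :=
  contDiffOn_infty.2 fun n ↦ contDiffOn_curry_family_nat hS n hf hF

end Family

end Summit.SmoothPoincare4.SmoothPoincare4.Cruxes.AhHadamardFilling.FisherSphereGauss

end
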